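import Summits.KontsevichZagierPeriods.Zeta5Search.TwoTaleOmega.FormalBarnesTPoly

/-!
# Formal Barnes functionals V — the second-tale (alternating) functional (cell `pub-zeta5`, fam-tele gen 4)

HONEST FRAMING: systematic search; no irrationality claim unless certified.

OUR infrastructure (Summit side; finite algebra only), blueprint `families/tele/RECURRENCE.md §13.1 (TALE 2)`.
Zudilin's second-tale integral is `r̂ = (1/2πi)∫ (π/sin 2πt) R̂(t) dt = −((−1)^{d̂}/2)·Σ_{m ≥ 1−â₀*} (−1)^m R̂(m/2)`
(proof of [Zudilin 2014, Prop. 3]).  In the lattice variable `u = 2t` this is the FORMAL ALTERNATING SUM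
`E_M[v] = "Σ_{m ≥ M} (−1)^m v(m)"` of partial-fraction data `v : PF` (poles of order `≤ 2` at integers `u = −K`),
with values in `ℚ·1 ⊕ ℚ·η₂ ⊕ ℚ·η` (`η₂ = Σ(−1)^{l−1}/l² = ζ(2)/2`, `η = Σ(−1)^{l−1}/l = log 2`), DEFINED coordinatewise
(`altE0 d M v`, `altE1 M v`, `altE2 v`) through Euler's transformation on the polynomial part
(`ePoly`, companion file `FormalBarnesTPoly`) and alternating-harmonic weights with the same reflection rule as
`FormalBarnes.phi0/psi0` (ibid.).  THEOREMS: one-step SHIFT law WITH SIGN `E_M[v(·+1)] = −E_{M+1}[v]` (`altE•_shift`), hence the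
clean two-step law for `t ↦ t+1` (`altE•_shift2`); CROSSING law `E_M[v] − E_{M+1}[v] = σ_M(v)` (`altE•_crossing`) with
the formal residue of `(π/sin πu)·v(u)` at `u = M`: `altRes0 M v = (−1)^M·(Q(M) + Σ α_K/(M+K) + Σ β_K/(M+K)²)`
(`x/0 = 0` drops the pole at `M` itself, correctly: a simple pole of `v` contributes no residue there) and
`altRes1 M v = 2(−1)^M β_{−M}` (`π/sin πu = (−1)^M[(u−M)⁻¹ + ζ(2)(u−M) + …]`); the `η`-coordinate `altE2` never
crosses.  The LINK with `SecondTale.formPT/formQT` is the companion file `FormalBarnesTLink`.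
-/

noncomputable section

open Polynomial Finset fwdDiff

namespace Summit.KontsevichZagierPeriods.Zeta5Search.FormalBarnes

/-! ### The functional on data, coordinatewise, and the formal residue -/

/-- `1`-coordinate of `E_M[v]` (truncation `d ≥ deg poly`). -/
def altE0 (d : ℕ) (M : ℤ) (v : PF) : ℚ :=
  ePoly d M v.poly + v.simple.sum (fun K a => a * sgnZ K * chi10 (K + M - 1))
    + v.double.sum (fun K b => b * sgnZ K * chi20 (K + M - 1))

/-- `η₂`-coordinate (`η₂ = ζ(2)/2`) of `E_M[v]`. -/
def altE1 (M : ℤ) (v : PF) : ℚ := v.double.sum (fun K b => b * sgnZ K * chi21 (K + M - 1))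

/-- `η`-coordinate (`η = log 2`) of `E_M[v]`: independent of `M`. -/
def altE2 (v : PF) : ℚ := v.simple.sum (fun K a => -(a * sgnZ K))

/-- `1`-coordinate of the formal residue of `(π/sin πu) v(u)` at `u = M`. -/
def altRes0 (M : ℤ) (v : PF) : ℚ :=
  sgnZ M * (v.poly.eval (M : ℚ) + v.simple.sum (fun K a => a / ((M : ℚ) + K))
    + v.double.sum (fun K b => b / ((M : ℚ) + K) ^ 2))

/-- `η₂`-coordinate of the formal residue at `u = M`: `2(−1)^M β_{−M}`. -/
def altRes1 (M : ℤ) (v : PF) : ℚ := 2 * sgnZ M * v.double (-M)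

/-! ### SHIFT laws -/

/-- SHIFT law (one lattice step, with sign), `1`-coordinate: `E⁰_M[v(·+1)] = −E⁰_{M+1}[v]`. -/
theorem altE0_shift (d : ℕ) (M : ℤ) (v : PF) : altE0 d M v.shift = -altE0 d (M + 1) v := by
  unfold altE0 PF.shift
  simp only
  rw [Finsupp.sum_mapDomain_index (fun _ => by simp) (fun _ _ _ => by ring),
    Finsupp.sum_mapDomain_index (fun _ => by simp) (fun _ _ _ => by ring), ePoly_shift, neg_add, neg_add]
  unfold Finsupp.sum
  rw [← sum_neg_distrib, ← sum_neg_distrib]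
  congr 1
  · congr 1
    exact Finset.sum_congr rfl fun K _ => by simp only [sgnZ_succ]; ring_nf
  · exact Finset.sum_congr rfl fun K _ => by simp only [sgnZ_succ]; ring_nf

/-- SHIFT law (one lattice step, with sign), `η₂`-coordinate. -/
theorem altE1_shift (M : ℤ) (v : PF) : altE1 M v.shift = -altE1 (M + 1) v := by
  unfold altE1 PF.shift
  simp only
  rw [Finsupp.sum_mapDomain_index (fun _ => by simp) (fun _ _ _ => by ring)]
  unfold Finsupp.sum
  rw [← sum_neg_distrib]
  exact Finset.sum_congr rfl fun K _ => by simp only [sgnZ_succ]; ring_nf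

/-- SHIFT law (one lattice step, with sign), `η`-coordinate. -/
theorem altE2_shift (v : PF) : altE2 v.shift = -altE2 v := by
  unfold altE2 PF.shift
  simp only
  rw [Finsupp.sum_mapDomain_index (fun _ => by simp) (fun _ _ _ => by ring)]
  unfold Finsupp.sum
  rw [← sum_neg_distrib]
  exact Finset.sum_congr rfl fun K _ => by simp only [sgnZ_succ]; ring

/-- Two-step shift (`t ↦ t+1` in Zudilin's variable `t = u/2`): no sign. -/
theorem altE0_shift2 (d : ℕ) (M : ℤ) (v : PF) : altE0 d M v.shift.shift = altE0 d (M + 2) v := by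
  rw [altE0_shift, altE0_shift, neg_neg, add_assoc]; norm_num

/-- Two-step shift, `η₂`-coordinate: no sign. -/
theorem altE1_shift2 (M : ℤ) (v : PF) : altE1 M v.shift.shift = altE1 (M + 2) v := by
  rw [altE1_shift, altE1_shift, neg_neg, add_assoc]; norm_num

/-- Two-step shift, `η`-coordinate: invariant. -/
theorem altE2_shift2 (v : PF) : altE2 v.shift.shift = altE2 v := by
  rw [altE2_shift, altE2_shift, neg_neg]

/-! ### CROSSING laws -/

/-- CROSSING law, `1`-coordinate: `E⁰_M[v] − E⁰_{M+1}[v] = σ⁰_M(v)` (truncation `d ≥ deg` of the polynomial part). -/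
theorem altE0_crossing (d : ℕ) (M : ℤ) (v : PF) (hd : v.poly.natDegree ≤ d) :
    altE0 d M v - altE0 d (M + 1) v = altRes0 M v := by
  unfold altE0 altRes0 Finsupp.sum
  have hP := ePoly_crossing d M v.poly hd
  have h1 : ∀ K ∈ v.simple.support,
      v.simple K * sgnZ K * chi10 (K + M - 1) - v.simple K * sgnZ K * chi10 (K + (M + 1) - 1)
        = sgnZ M * (v.simple K / ((M : ℚ) + K)) := by
    intro K _
    have e : (((K + M - 1 : ℤ) : ℚ) + 1) = (M : ℚ) + K := by push_cast; ring
    rw [← mul_sub, show K + (M + 1) - 1 = (K + M - 1) + 1 by ring, chi10_crossing, e, sub_add_cancel, sgnZ_add]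
    linear_combination (sgnZ M * v.simple K / ((M : ℚ) + K)) * sgnZ_mul_self K
  have h2 : ∀ K ∈ v.double.support,
      v.double K * sgnZ K * chi20 (K + M - 1) - v.double K * sgnZ K * chi20 (K + (M + 1) - 1)
        = sgnZ M * (v.double K / ((M : ℚ) + K) ^ 2) := by
    intro K _
    have e : (((K + M - 1 : ℤ) : ℚ) + 1) = (M : ℚ) + K := by push_cast; ring
    rw [← mul_sub, show K + (M + 1) - 1 = (K + M - 1) + 1 by ring, chi20_crossing, e, sub_add_cancel, sgnZ_add]
    linear_combination (sgnZ M * v.double K / ((M : ℚ) + K) ^ 2) * sgnZ_mul_self K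
  have e1 := Finset.sum_congr rfl h1
  have e2 := Finset.sum_congr rfl h2
  rw [Finset.sum_sub_distrib] at e1 e2
  rw [← Finset.mul_sum] at e1 e2
  linear_combination hP + e1 + e2

/-- CROSSING law, `η₂`-coordinate: `E¹_M[v] − E¹_{M+1}[v] = σ¹_M(v) = 2(−1)^M β_{−M}`. -/
theorem altE1_crossing (M : ℤ) (v : PF) : altE1 M v - altE1 (M + 1) v = altRes1 M v := by
  unfold altE1 altRes1 Finsupp.sum
  rw [← Finset.sum_sub_distrib]
  have h : ∀ K ∈ v.double.support,
      v.double K * sgnZ K * chi21 (K + M - 1) - v.double K * sgnZ K * chi21 (K + (M + 1) - 1)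
        = if K = -M then 2 * sgnZ M * v.double K else 0 := by
    intro K _
    rw [← mul_sub, show K + (M + 1) - 1 = (K + M - 1) + 1 by ring, chi21_crossing]
    by_cases hK : K = -M
    · subst hK; simp [sgnZ_neg]; ring
    · have : K + M - 1 ≠ -1 := fun h => hK (by linarith)
      simp [hK, this]
  rw [Finset.sum_congr rfl h, Finset.sum_ite_eq']
  by_cases hs : -M ∈ v.double.support
  · rw [if_pos hs]
  · rw [if_neg hs, Finsupp.notMem_support_iff.1 hs, mul_zero]

/-! ### Linearity, moves, telescoping -/

/-- Additivity of `E⁰` in the data. -/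
theorem altE0_add (d : ℕ) (M : ℤ) (v w : PF) : altE0 d M (v.add w) = altE0 d M v + altE0 d M w := by
  unfold altE0 PF.add
  simp only
  rw [ePoly_add, Finsupp.sum_add_index' (fun _ => by ring) (fun _ _ _ => by ring),
    Finsupp.sum_add_index' (fun _ => by ring) (fun _ _ _ => by ring)]
  ring

/-- Additivity of `E¹` in the data. -/
theorem altE1_add (M : ℤ) (v w : PF) : altE1 M (v.add w) = altE1 M v + altE1 M w := by
  unfold altE1 PF.add
  simp only
  rw [Finsupp.sum_add_index' (fun _ => by ring) (fun _ _ _ => by ring)]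

/-- Additivity of `E²` in the data. -/
theorem altE2_add (v w : PF) : altE2 (v.add w) = altE2 v + altE2 w := by
  unfold altE2 PF.add
  simp only
  rw [Finsupp.sum_add_index' (fun _ => by ring) (fun _ _ _ => by ring)]

/-- Homogeneity of `E⁰` in the data. -/
theorem altE0_smul (d : ℕ) (M : ℤ) (c : ℚ) (v : PF) : altE0 d M (v.smul c) = c * altE0 d M v := by
  unfold altE0 PF.smul
  simp only
  rw [ePoly_smul, Finsupp.sum_smul_index' (fun _ => by ring), Finsupp.sum_smul_index' (fun _ => by ring)]
  simp only [smul_eq_mul]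
  unfold Finsupp.sum
  rw [mul_add, mul_add, Finset.mul_sum, Finset.mul_sum]
  congr 1
  · congr 1
    exact Finset.sum_congr rfl fun _ _ => by ring
  · exact Finset.sum_congr rfl fun _ _ => by ring

/-- Homogeneity of `E¹` in the data. -/
theorem altE1_smul (M : ℤ) (c : ℚ) (v : PF) : altE1 M (v.smul c) = c * altE1 M v := by
  unfold altE1 PF.smul
  simp only
  rw [Finsupp.sum_smul_index' (fun _ => by ring)]
  simp only [smul_eq_mul]
  unfold Finsupp.sum
  rw [Finset.mul_sum]
  exact Finset.sum_congr rfl fun _ _ => by ring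

/-- Moving the node `n` steps to the right: `E_M − E_{M+n} = Σ_{i<n} σ_{M+i}`. -/
theorem altE0_move (d : ℕ) (M : ℤ) (v : PF) (hd : v.poly.natDegree ≤ d) (n : ℕ) :
    altE0 d M v - altE0 d (M + n) v = ∑ i ∈ range n, altRes0 (M + i) v := by
  induction n with
  | zero => simp
  | succ n ih =>
    rw [sum_range_succ, ← ih, show M + ((n + 1 : ℕ) : ℤ) = (M + n) + 1 by push_cast; ring,
      ← altE0_crossing d (M + n) v hd]
    ring

/-- Moving the node `n` steps to the right, `η₂`-coordinate. -/
theorem altE1_move (M : ℤ) (v : PF) (n : ℕ) :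
    altE1 M v - altE1 (M + n) v = ∑ i ∈ range n, altRes1 (M + i) v := by
  induction n with
  | zero => simp
  | succ n ih =>
    rw [sum_range_succ, ← ih, show M + ((n + 1 : ℕ) : ℤ) = (M + n) + 1 by push_cast; ring,
      ← altE1_crossing (M + n) v]
    ring

/-- **Telescoping step, second tale**: for `u = S²w` (Zudilin's `t ↦ t+1`),
`E_M[S²w] − E_M[w] = −(σ_M(w) + σ_{M+1}(w))`. -/
theorem altE0_telescope2 (d : ℕ) (M : ℤ) (u w : PF) (hu : u = w.shift.shift) (hd : w.poly.natDegree ≤ d) :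
    altE0 d M u - altE0 d M w = -(altRes0 M w + altRes0 (M + 1) w) := by
  subst hu
  rw [altE0_shift2, ← altE0_crossing d M w hd, ← altE0_crossing d (M + 1) w hd,
    show M + 1 + 1 = M + 2 by ring]
  ring

/-- **Telescoping step, second tale, `η₂`-coordinate**: for `u = S²w`, `E¹_M[u] − E¹_M[w] = −(σ¹_M +
σ¹_{M+1})(w)`. -/
theorem altE1_telescope2 (M : ℤ) (u w : PF) (hu : u = w.shift.shift) :
    altE1 M u - altE1 M w = -(altRes1 M w + altRes1 (M + 1) w) := by
  subst hu
  rw [altE1_shift2, ← altE1_crossing M w, ← altE1_crossing (M + 1) w, show M + 1 + 1 = M + 2 by ring]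
  ring

/-- **Telescoping step, second tale, `η`-coordinate**: it does not move (so `Σ_k B_k = 0` is never needed). -/
theorem altE2_telescope2 (u w : PF) (hu : u = w.shift.shift) : altE2 u - altE2 w = 0 := by
  subst hu; rw [altE2_shift2, sub_self]

end Summit.KontsevichZagierPeriods.Zeta5Search.FormalBarnes
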